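import Summits.ValiantsHypothesis.ValiantsHypothesis.Theorems.FeketeSOSFeketeSOSHardPaleyRIPSmallSetEquiv

/-!
# Route FeketeSOS — crux `FeketeSOSHard` (stmt-ValiantsHypothesis-3996), line `paley-rip`,
# stub `stub_paleyFlatRIP`: the `1/2` barrier in kernel — `𝒫(α, β)` holds for EVERY `α > 1/2`

`…PaleyRIPSmallSetEquiv.lean` identifies the engine `stub_paleyFlatRIP` with the Paley graph property
`𝒫(α, β)` for SOME `α < 1/2` (power-saving discrepancy `|Σ_{a∈A,b∈B} χ_p(a±b)| ≤ (#A·#B)^{1−β/2}` for all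
`A, B ⊆ [0,p)` of size `≥ p^α`).  This file records the other side of the barrier, sorry-free and at EVERY
prime (no threshold): `𝒫(α, 1 − 1/(2α))` holds for every `α > 1/2`, in sum and difference form, by the
completion bound `|Σ_{a∈A,b∈B} χ_p(a+b)| ≤ √p·√(#A·#B)` (`charSum_le_sqrt_p_mul`, from the landed
`stub_paleyCompletionBound`) — the theorem of Chor–Goldreich 1988 (two-source extraction above min-entropy
rate `1/2`; Lemma 5 / Cor. 11 format) and the "trivial" half of Chung's problem.  So the kernel now shows
the line's engine to be EXACTLY the crossing of the exponent `1/2`: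

* `smallSetDiscrepancy_of_half_lt` — `α > 1/2` ⇒ for every prime `p` and all `A, B ⊆ [0,p)` with
  `#A, #B ≥ p^α`: `|Σ χ_p(a+b)| ≤ (#A·#B)^{1 − (1 − 1/(2α))/2}`;
* `smallSetDiffDiscrepancy_of_half_lt` — the same for `χ_p(a−b)` (reflection `B ↦ −B`);
* `paleyGraphProperty_above_half`, `paleySumGraphProperty_above_half` — packaged as `∃ β > 0 ∀ p` for
  each `α > 1/2` (for `α > 1` the hypothesis `#A ≥ p^α` is never met, as `#A ≤ p`; harmless).

Honest framing: the `α > 1/2` range is classical and unconditional; every `α < 1/2` (= the engine) is OPEN;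
nothing here bears on the crux `FeketeSOSHard` beyond locating its engine, nor on `VP ≠ VNP`.
-/

-- the line's namespace repeats a path segment by convention (same as the other paley-rip files)
set_option linter.dupNamespace false

namespace Summit.ValiantsHypothesis.ValiantsHypothesis.Theorems.FeketeSOSHardPaleyRIP

open Finset
open scoped BigOperators

noncomputable section

section HalfBarrier

/-- **Chor–Goldreich range (sum form).**  For `α > 1/2`, every prime `p` and all `A, B ⊆ [0,p)` with
`#A, #B ≥ p^α`: `|Σ_{a∈A,b∈B} χ_p(a+b)| ≤ (#A·#B)^{1−β/2}` with `β = 1 − 1/(2α) > 0` (completion bound: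
`√p ≤ (#A·#B)^{1/(4α)}`). [folklore] -/
theorem smallSetDiscrepancy_of_half_lt (α : ℝ) (hα : 1 / 2 < α) (p : ℕ) [Fact p.Prime]
    (A B : Finset ℕ) (hA : ∀ a ∈ A, a < p) (hB : ∀ b ∈ B, b < p)
    (hAc : (p : ℝ) ^ α ≤ (A.card : ℝ)) (hBc : (p : ℝ) ^ α ≤ (B.card : ℝ)) :
    ‖∑ a ∈ A, ∑ b ∈ B, ((legendreSym p ((a : ℤ) + b) : ℤ) : ℂ)‖ ≤
      ((A.card : ℝ) * B.card) ^ (1 - (1 - 1 / (2 * α)) / 2) := by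
  have hprime : p.Prime := Fact.out
  have hp0 : (0 : ℝ) < (p : ℝ) := by exact_mod_cast hprime.pos
  have hα0 : 0 < α := by linarith
  set x : ℝ := (A.card : ℝ) with hx
  set y : ℝ := (B.card : ℝ) with hy
  have hpα : 0 < (p : ℝ) ^ α := Real.rpow_pos_of_pos hp0 α
  have hxpos : 0 < x := lt_of_lt_of_le hpα hAc
  have hypos : 0 < y := lt_of_lt_of_le hpα hBc
  have hxy0 : 0 < x * y := mul_pos hxpos hypos
  -- `p^{2α} ≤ xy`, hence `√p = (p^{2α})^{1/(4α)} ≤ (xy)^{1/(4α)}`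
  have hxyα : (p : ℝ) ^ (2 * α) ≤ x * y := by
    have h := mul_le_mul hAc hBc hpα.le hxpos.le
    rwa [← Real.rpow_add hp0, show α + α = 2 * α by ring] at h
  have hsqrt : Real.sqrt p ≤ (x * y) ^ (1 / (4 * α)) := by
    have h4α : 0 < 4 * α := by linarith
    calc Real.sqrt p = (p : ℝ) ^ (1 / 2 : ℝ) := Real.sqrt_eq_rpow _
      _ = ((p : ℝ) ^ (2 * α)) ^ (1 / (4 * α)) := by
          rw [← Real.rpow_mul hp0.le]; congr 1; field_simp; ring
      _ ≤ (x * y) ^ (1 / (4 * α)) :=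
          Real.rpow_le_rpow (Real.rpow_nonneg hp0.le _) hxyα (by positivity)
  -- target exponent: `1 − (1 − 1/(2α))/2 = 1/2 + 1/(4α)`
  have hsplit : (x * y) ^ (1 - (1 - 1 / (2 * α)) / 2) = (x * y) ^ (1 / (4 * α)) * Real.sqrt (x * y) := by
    rw [Real.sqrt_eq_rpow, ← Real.rpow_add hxy0]
    congr 1
    field_simp
    ring
  rw [hsplit]
  exact (charSum_le_sqrt_p_mul p A B hA hB).trans
    (mul_le_mul_of_nonneg_right hsqrt (Real.sqrt_nonneg _))

/-- **Chor–Goldreich range (difference / Paley-graph form).**  The same bound for `χ_p(a−b)`, by the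
reflection `B ↦ −B (mod p)`. [folklore] -/
theorem smallSetDiffDiscrepancy_of_half_lt (α : ℝ) (hα : 1 / 2 < α) (p : ℕ) [Fact p.Prime]
    (A B : Finset ℕ) (hA : ∀ a ∈ A, a < p) (hB : ∀ b ∈ B, b < p)
    (hAc : (p : ℝ) ^ α ≤ (A.card : ℝ)) (hBc : (p : ℝ) ^ α ≤ (B.card : ℝ)) :
    ‖∑ a ∈ A, ∑ b ∈ B, ((legendreSym p ((a : ℤ) - b) : ℤ) : ℂ)‖ ≤
      ((A.card : ℝ) * B.card) ^ (1 - (1 - 1 / (2 * α)) / 2) := by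
  classical
  have h := smallSetDiscrepancy_of_half_lt α hα p A (B.image (fun b : ℕ => (p - b) % p)) hA
    (reflect_lt p B) hAc (by rw [card_reflect p B hB]; exact hBc)
  rwa [charSum_reflect p A B hB, card_reflect p B hB] at h

/-- **The `1/2` barrier, packaged.**  For every `α > 1/2` there is `β > 0` (namely `1 − 1/(2α)`) such that
the Paley graph property `𝒫(α, β)` holds at EVERY prime: `|Σ_{a∈A,b∈B} χ_p(a−b)| ≤ (#A·#B)^{1−β/2}` for
all `A, B ⊆ [0,p)` with `#A, #B ≥ p^α` (Chor–Goldreich 1988).  Contrast `flatRIP_iff_smallSetDiffDiscrepancy`: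
the engine `stub_paleyFlatRIP` is the same property for SOME `α < 1/2`, which is open. [folklore] -/
theorem paleyGraphProperty_above_half (α : ℝ) (hα : 1 / 2 < α) :
    ∃ β : ℝ, 0 < β ∧ ∀ (p : ℕ) [Fact p.Prime] (A B : Finset ℕ), (∀ a ∈ A, a < p) → (∀ b ∈ B, b < p) →
      (p : ℝ) ^ α ≤ (A.card : ℝ) → (p : ℝ) ^ α ≤ (B.card : ℝ) →
      ‖∑ a ∈ A, ∑ b ∈ B, ((legendreSym p ((a : ℤ) - b) : ℤ) : ℂ)‖ ≤
        ((A.card : ℝ) * B.card) ^ (1 - β / 2) := by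
  have hα0 : 0 < α := by linarith
  refine ⟨1 - 1 / (2 * α), ?_, fun p _ A B hA hB hAc hBc =>
    smallSetDiffDiscrepancy_of_half_lt α hα p A B hA hB hAc hBc⟩
  rw [sub_pos, div_lt_one (by positivity)]
  linarith

/-- The sum-form package of the same statement. [folklore] -/
theorem paleySumGraphProperty_above_half (α : ℝ) (hα : 1 / 2 < α) :
    ∃ β : ℝ, 0 < β ∧ ∀ (p : ℕ) [Fact p.Prime] (A B : Finset ℕ), (∀ a ∈ A, a < p) → (∀ b ∈ B, b < p) →
      (p : ℝ) ^ α ≤ (A.card : ℝ) → (p : ℝ) ^ α ≤ (B.card : ℝ) →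
      ‖∑ a ∈ A, ∑ b ∈ B, ((legendreSym p ((a : ℤ) + b) : ℤ) : ℂ)‖ ≤
        ((A.card : ℝ) * B.card) ^ (1 - β / 2) := by
  have hα0 : 0 < α := by linarith
  refine ⟨1 - 1 / (2 * α), ?_, fun p _ A B hA hB hAc hBc =>
    smallSetDiscrepancy_of_half_lt α hα p A B hA hB hAc hBc⟩
  rw [sub_pos, div_lt_one (by positivity)]
  linarith

end HalfBarrier

end

end Summit.ValiantsHypothesis.ValiantsHypothesis.Theorems.FeketeSOSHardPaleyRIP
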